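import Literature.NumberTheory.Transcendental.MultipleZetaValuesHoffmanProofs
import HarnessLib

/-!
# Brown, *Mixed Tate motives over ℤ* (2012) — the final deduction: Theorem 7.4 and the
# dimension count (7.2) imply Conjecture 2 (`hoffmanSpan_eq_mzvSpace`)

Sibling file in the cone of the named fact
`Literature.NumberTheory.Transcendental.hoffmanSpan_eq_mzvSpace` (Brown 2012, Theorem 1.1 ⟹
Conjecture 2). The last paragraph of Brown's proof (§7.2, after Theorem 7.4) is pure linear algebra:
the motivic multiple zeta values of weight `N` live in a `ℚ`-vector space
`H_N ⊆ H_N^{MT⁺}` of dimension `≤ d_N` (`dim H_N^{MT⁺} = d_N`, (2.23), from the structure of the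
category `MT(ℤ)`, Deligne–Goncharov); the `d_N` Hoffman elements `ζᵐ(w)`, `w ∈ {2,3}^×` of
weight `N`, are linearly independent in it (Theorem 7.4, the heart of the paper: coaction,
`D_{2r+1}`, Zagier's theorem, `2`-adic matrices); hence ((7.2)) they span, every `ζᵐ(s)` is a
rational combination of Hoffman `ζᵐ(w)`, and applying the period map `per : H → ℝ` (2.11),
`per(ζᵐ(s)) = ζ(s)`, gives Conjecture 2 in weight `N` (Corollary 7.5 ⟹ Conjecture 2, p. 19).

We package exactly these inputs as a structure `Brown2012.HoffmanModel N` — a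
finite-dimensional `ℚ`-space `V` with `dim V ≤ d_N`, vectors `lift s` for the admissible indices
`s` of weight `N`, a `ℚ`-linear `per : V → ℝ` with `per (lift s) = ζ(s)`, and the linear
independence of the Hoffman lifts — and PROVE the deduction:

* `Brown2012.hoffmanSpan_eq_of_hoffmanModel` : a Hoffman model in weight `N` gives
  `hoffmanSpan N = mzvSpace N`; `Brown2012.finrank_eq_zagierDim_of_hoffmanModel` : and then
  `dim V = d_N` ((7.2): the inclusions `H^{2,3} ⊆ H ⊆ H^{MT⁺}` are equalities);
* `hoffmanSpan_eq_mzvSpace_of_hoffmanModel` : Hoffman models in all weights give the named fact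
  `hoffmanSpan_eq_mzvSpace` — i.e. the fact is reduced to the existence of Brown's motivic data
  (the category `MT(ℤ)` with (2.23), motivic MZVs with their period map, and Theorem 7.4), none
  of which is available in Mathlib.

This is a DEFINITIONS file (the structure `HoffmanModel`); it introduces no named facts (no
`def … : Prop`), the structure being a hypothesis bundle used only in the binders of the theorems
above (D-0026).

## References

* F. Brown, *Mixed Tate motives over ℤ*, Ann. of Math. **175** (2012), 949–976: (2.11), (2.23),
  Theorem 7.4, (7.2), Corollary 7.5 (arXiv:1102.1312, pp. 5–7, 18–19). [Brown2012]
-/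

noncomputable section

namespace Literature.NumberTheory.Transcendental

namespace Brown2012

/-- **Brown's motivic data in weight `N`, abstractly** (what §7.2 of Brown 2012 uses to deduce
Conjecture 2 from Theorem 7.4): a finite-dimensional `ℚ`-vector space `V` (Brown's
`H_N ⊆ H_N^{MT⁺}`) of dimension `≤ d_N` ((2.23): `dim H_N^{MT⁺} = d_N`), motivic lifts
`lift s ∈ V` of the multiple zeta values of the admissible indices `s` of weight `N` (`ζᵐ(s)`,
Definition 2.1/(2.12)), a `ℚ`-linear period map `per : V → ℝ` with `per (lift s) = ζ(s)` ((2.11),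
(2.13)), and the linear independence of the Hoffman lifts `lift w`, `w ∈ {2,3}^×` of weight `N`
(Theorem 7.4). [cite: Brown2012, §7.2 Theorem 7.4 and (7.2)] -/
structure HoffmanModel (N : ℕ) where
  /-- The weight-`N` motivic space (Brown's `H_N`, inside `H_N^{MT⁺}`). -/
  V : Type
  [instAddCommGroup : AddCommGroup V]
  [instModule : Module ℚ V]
  [instFiniteDimensional : FiniteDimensional ℚ V]
  /-- `dim H_N ≤ dim H_N^{MT⁺} = d_N` (Brown 2012, (2.23)). -/
  finrank_le : Module.finrank ℚ V ≤ zagierDim N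
  /-- The motivic lifts `ζᵐ(s)` of the admissible indices of weight `N`. -/
  lift : {s : List ℕ // MZV.IsAdmissible s ∧ MZV.weight s = N} → V
  /-- The period map (Brown 2012, (2.11)). -/
  per : V →ₗ[ℚ] ℝ
  /-- `per (ζᵐ(s)) = ζ(s)` (Brown 2012, (2.13)). -/
  per_lift : ∀ s, per (lift s) = multipleZeta s.1
  /-- **Theorem 7.4**: the Hoffman lifts are linearly independent. -/
  linearIndependent_hoffman :
    LinearIndependent ℚ fun w : {w : List ℕ // MZV.IsHoffman w ∧ MZV.weight w = N} =>
      lift ⟨w.1, w.2.1.isAdmissible, w.2.2⟩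

attribute [instance] HoffmanModel.instAddCommGroup HoffmanModel.instModule
  HoffmanModel.instFiniteDimensional

variable {N : ℕ}

/-- In a Hoffman model the Hoffman lifts span `V` and `dim V = d_N` (Brown 2012, (7.2):
"`dim H_N^{2,3} = #{w ∈ {2,3}^× of weight N} = d_N` … the inclusions `H^{2,3} ⊆ H ⊆ H^{MT⁺}` are
therefore all equalities"). [cite: Brown2012, §7.2 (7.2)] -/
theorem span_hoffman_eq_top_of_hoffmanModel (M : HoffmanModel N) :
    Submodule.span ℚ (Set.range fun w : {w : List ℕ // MZV.IsHoffman w ∧ MZV.weight w = N} =>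
      M.lift ⟨w.1, w.2.1.isAdmissible, w.2.2⟩) = ⊤ ∧
    Module.finrank ℚ M.V = zagierDim N := by
  haveI := finite_hoffman N
  letI : Fintype {w : List ℕ // MZV.IsHoffman w ∧ MZV.weight w = N} := Fintype.ofFinite _
  have hcard : Fintype.card {w : List ℕ // MZV.IsHoffman w ∧ MZV.weight w = N} = zagierDim N := by
    rw [← Nat.card_eq_fintype_card]
    exact card_hoffman_eq_zagierDim N
  have hle : Fintype.card {w : List ℕ // MZV.IsHoffman w ∧ MZV.weight w = N} ≤
      Module.finrank ℚ M.V := M.linearIndependent_hoffman.fintype_card_le_finrank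
  have heq : Fintype.card {w : List ℕ // MZV.IsHoffman w ∧ MZV.weight w = N} =
      Module.finrank ℚ M.V := le_antisymm hle (by rw [hcard]; exact M.finrank_le)
  exact ⟨M.linearIndependent_hoffman.span_eq_top_of_card_eq_finrank' heq, by rw [← heq, hcard]⟩

/-- `dim V = d_N` in a Hoffman model (Brown 2012, (7.2)). [cite: Brown2012, §7.2 (7.2)] -/
theorem finrank_eq_zagierDim_of_hoffmanModel (M : HoffmanModel N) :
    Module.finrank ℚ M.V = zagierDim N :=
  (span_hoffman_eq_top_of_hoffmanModel M).2

/-- **Brown 2012, §7.2: Theorem 7.4 ⟹ Conjecture 2 in weight `N`.** A Hoffman model in weight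
`N` gives `hoffmanSpan N = mzvSpace N`: every `ζᵐ(s)` is a rational combination of the Hoffman
`ζᵐ(w)` (they span `V`), and the period map carries this to `ζ(s) ∈ hoffmanSpan N`
(Corollary 7.5 ⟹ Conjecture 2, "by applying the period map", p. 1 and p. 19).
[cite: Brown2012, §7.2 Corollary 7.5] -/
theorem hoffmanSpan_eq_of_hoffmanModel (M : HoffmanModel N) : hoffmanSpan N = mzvSpace N := by
  refine hoffmanSpan_eq_mzvSpace_of_forall_mem fun s hs hw => ?_
  have hspan := (span_hoffman_eq_top_of_hoffmanModel M).1
  have hmem : M.lift ⟨s, hs, hw⟩ ∈ Submodule.span ℚ (Set.range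
      fun w : {w : List ℕ // MZV.IsHoffman w ∧ MZV.weight w = N} =>
        M.lift ⟨w.1, w.2.1.isAdmissible, w.2.2⟩) := by
    rw [hspan]; exact Submodule.mem_top
  have hmap : Submodule.map M.per (Submodule.span ℚ (Set.range
      fun w : {w : List ℕ // MZV.IsHoffman w ∧ MZV.weight w = N} =>
        M.lift ⟨w.1, w.2.1.isAdmissible, w.2.2⟩)) ≤ hoffmanSpan N := by
    rw [Submodule.map_span, Submodule.span_le]
    rintro _ ⟨_, ⟨w, rfl⟩, rfl⟩
    rw [M.per_lift]
    exact Submodule.subset_span ⟨w.1, w.2.1, w.2.2, rfl⟩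
  rw [← M.per_lift ⟨s, hs, hw⟩]
  exact hmap (Submodule.mem_map_of_mem hmem)

end Brown2012

/-- **The named fact, reduced to Brown's motivic data**: Hoffman models in all weights (Brown's
`H_N ⊆ H_N^{MT⁺}` with `dim ≤ d_N`, the motivic MZVs with their period map, and the linear
independence Theorem 7.4) give `hoffmanSpan_eq_mzvSpace` (Brown 2012, Theorem 1.1 ⟹
Conjecture 2). [cite: Brown2012, §7.2 Corollary 7.5] -/
theorem hoffmanSpan_eq_mzvSpace_of_hoffmanModel (M : ∀ N, Brown2012.HoffmanModel N) :
    hoffmanSpan_eq_mzvSpace := fun N => Brown2012.hoffmanSpan_eq_of_hoffmanModel (M N)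

/-- And then `dim_ℚ 𝒵_N ≤ d_N` for all `N` (the named fact `finrank_mzvSpace_le_zagierDim`,
Terasoma / Deligne–Goncharov), via `finrank_mzvSpace_le_zagierDim_of_hoffmanSpan_eq`.
[cite: Brown2012, §1] -/
theorem finrank_mzvSpace_le_zagierDim_of_hoffmanModel (M : ∀ N, Brown2012.HoffmanModel N) :
    finrank_mzvSpace_le_zagierDim :=
  finrank_mzvSpace_le_zagierDim_of_hoffmanSpan_eq (hoffmanSpan_eq_mzvSpace_of_hoffmanModel M)

end Literature.NumberTheory.Transcendental
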